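/-
COR-CM (cell pub-hodgecm2) — ¬hJ lane (lead d2bridge-wb-9 g7), milestone M1 of `NOT-HJ-CENSUS.md` §4 (route P′ «purity from Prop 4.13»):
the PURE ALGEBRA of multiplicity-free semisimple modules.  Pen prover-pub-hodgecm2-mukey-p10-g2-0 (mukey-p10 g2); statements = wb-9's
`HOME/d2bridge/wb-9/nothj/M1Statement.lean` VERBATIM (four signatures), proofs supplied here.  Mathlib only; theorems only; no `sorry`.
HC_CM is NOT proved; nothing here asserts hJ or ¬hJ; HELD — WORLD = C FINAL.
-/
import Mathlib

/-!
# ¬hJ lane, milestone M1: multiplicity-free semisimple modules admit no «exchange» endomorphism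

Pure algebra, no tree objects.  A module `H` over a ring `R` that is an INTERNAL DIRECT SUM of pairwise NON-ISOMORPHIC SIMPLE submodules
`C i` («multiplicity-free semisimple») has:
* `map_le_self_of_multiplicityFree` (M1a): every `R`-endomorphism maps each `C i` into itself (Schur);
* `le_or_le_of_isCompl_of_multiplicityFree` (M1b): for every complementary pair of SUBMODULES `P ⊕ Q = H`, each `C i` lies in `P` or in `Q`;
* `eq_zero_of_exchange_of_multiplicityFree` (M1c): an `R`-endomorphism exchanging `P` and `Q` (`E P ≤ Q`, `E Q ≤ P`) is ZERO;
* `isInternal_map_of_equiv` (bridge): the displayed shape of [Liu2021, Prop. 4.13] `H ≃ₗ[R] ⨁ t, Ω t` yields an internal direct sum of `H`.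
Consumer (M2∕M4 of NOT-HJ-CENSUS §4): `R := MonoidAlgebra ℂ G`, `H := 𝔇.H`, `C t := oscImage t`, `P ∕ Q` := tower Hodge parts,
`E` := the anti-Hodge equivariant endomorphism a hypothetical `J₁` would produce (M3).

## References
* [Liu2021] Y. Liu, *Fourier–Jacobi cycles and arithmetic relative trace formula*, Camb. J. Math. 9 (2021), Prop. 4.13 (FJcycle.tex l. 2113–2119),
  Def. 4.11 (l. 2083–2097), App. D Lem. D.1 (3) (l. 5233) — the displayed rows whose SHAPE (multiplicity-free semisimple `H`) this algebra serves.
* Schur's lemma: Mathlib `LinearMap.bijective_or_eq_zero`.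
-/

namespace Summit.HodgeConjecture.CorCM.D2Bridge.NotHJ

variable {R : Type*} [Ring R] {H : Type*} [AddCommGroup H] [Module R H] {ι : Type*} [DecidableEq ι]

/-- Component bookkeeping for an internal direct sum: with the decomposition chosen from `hint`, the `j`-component of `E x`, for
`x ∈ C i` and `j ≠ i`, vanishes whenever the `C k` are simple and pairwise non-isomorphic (Schur's lemma applied to the composite
`C i → H → H → C j`). [cite: Liu2021, Prop. 4.13 (FJcycle.tex l. 2113–2119)] -/
theorem decompose_map_apply_eq_zero_of_ne (C : ι → Submodule R H) [DirectSum.Decomposition C]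
    (hs : ∀ i, IsSimpleModule R (C i)) (hni : ∀ i j, Nonempty (C i ≃ₗ[R] C j) → i = j)
    (E : H →ₗ[R] H) {i j : ι} (hij : j ≠ i) {x : H} (hx : x ∈ C i) :
    (DirectSum.decompose C (E x) j : H) = 0 := by
  haveI := hs i
  haveI := hs j
  -- the Schur composite `C i → C j`
  let f : C i →ₗ[R] C j :=
    (DirectSum.component R ι (fun k => (C k)) j) ∘ₗ (DirectSum.decomposeLinearEquiv C).toLinearMap ∘ₗ E ∘ₗ (C i).subtype
  have hf : ∀ y : C i, (f y : H) = (DirectSum.decompose C (E (y : H)) j : H) := by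
    intro y
    rfl
  rcases LinearMap.bijective_or_eq_zero f with hb | h0
  · exact absurd (hni i j ⟨LinearEquiv.ofBijective f hb⟩) (Ne.symm hij)
  · have h1 : (f ⟨x, hx⟩ : H) = 0 := by
      rw [h0]
      rfl
    rw [hf] at h1
    exact h1

/-- **M1a.** In a multiplicity-free semisimple module every endomorphism preserves each simple component.
Sketch: for `x ∈ C i` and `j ≠ i`, the composite `C i → H →(E) H →(proj_j) C j` is an `R`-map between non-isomorphic simples, hence `0`
(Schur: a non-zero map between simples is bijective, giving `C i ≃ C j`, so `i = j`); so every `j ≠ i` component of `E x` vanishes and `E x ∈ C i`.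
[cite: Liu2021, Prop. 4.13 (FJcycle.tex l. 2113–2119)] -/
theorem map_le_self_of_multiplicityFree (C : ι → Submodule R H) (hint : DirectSum.IsInternal C)
    (hs : ∀ i, IsSimpleModule R (C i)) (hni : ∀ i j, Nonempty (C i ≃ₗ[R] C j) → i = j)
    (E : H →ₗ[R] H) (i : ι) : (C i).map E ≤ C i := by
  classical
  letI : DirectSum.Decomposition C := hint.chooseDecomposition
  rintro _ ⟨x, hx, rfl⟩
  have key : ∀ j, j ≠ i → (DirectSum.decompose C (E x) j : H) = 0 := fun j hji =>
    decompose_map_apply_eq_zero_of_ne C hs hni E hji hx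
  rw [← DirectSum.sum_support_decompose C (E x)]
  refine Submodule.sum_mem _ fun j _ => ?_
  by_cases hji : j = i
  · subst hji
    exact (DirectSum.decompose C (E x) j).2
  · rw [key j hji]
    exact zero_mem _

/-- **M1b.** Each simple component lies inside `P` or inside `Q` for any complementary pair of submodules.
Sketch: the projection onto `P` along `Q`, as an endomorphism of `H`, preserves `C i` by M1a; restricted to the simple `C i` it is `0` or
bijective (Schur for endomorphisms): if `0` then `C i ≤ Q`, if bijective then `C i ≤ P`.
[cite: Liu2021, Prop. 4.13 (FJcycle.tex l. 2113–2119)] -/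
theorem le_or_le_of_isCompl_of_multiplicityFree (C : ι → Submodule R H) (hint : DirectSum.IsInternal C)
    (hs : ∀ i, IsSimpleModule R (C i)) (hni : ∀ i j, Nonempty (C i ≃ₗ[R] C j) → i = j)
    {P Q : Submodule R H} (hPQ : IsCompl P Q) (i : ι) : C i ≤ P ∨ C i ≤ Q := by
  haveI := hs i
  -- the projection onto `P` along `Q`, as an endomorphism of `H`
  let π : H →ₗ[R] H := P.subtype ∘ₗ P.projectionOnto Q hPQ
  have hπ : ∀ x, x ∈ C i → π x ∈ C i := fun x hx =>
    map_le_self_of_multiplicityFree C hint hs hni π i ⟨x, hx, rfl⟩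
  let g : C i →ₗ[R] C i := π.restrict hπ
  rcases LinearMap.bijective_or_eq_zero g with hb | h0
  · -- bijective: every `y ∈ C i` is `π x` for some `x ∈ C i`, hence lies in `P`
    left
    intro y hy
    obtain ⟨x, hxy⟩ := hb.2 ⟨y, hy⟩
    have : (π (x : H)) = y := by
      have := congrArg Subtype.val hxy
      simpa [g] using this
    rw [← this]
    exact (P.projectionOnto Q hPQ (x : H)).2
  · -- zero: every `x ∈ C i` has zero projection onto `P`, hence lies in `Q`
    right
    intro x hx
    have h1 : g ⟨x, hx⟩ = 0 := by rw [h0]; rfl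
    have h2 : π x = 0 := by
      have := congrArg Subtype.val h1
      simpa [g] using this
    have h3 : P.projectionOnto Q hPQ x = 0 := by
      apply Subtype.ext
      simpa [π] using h2
    exact (Submodule.projectionOnto_apply_eq_zero_iff hPQ).1 h3

/-- **M1c — the obstruction.** An endomorphism exchanging the two summands of a complementary pair of submodules of a multiplicity-free
semisimple module is zero.  Sketch: by M1a `E (C i) ≤ C i`; by M1b `C i ≤ P` (then `E (C i) ≤ Q ⊓ C i ≤ Q ⊓ P = ⊥`) or `C i ≤ Q` (symmetric);
so `E` vanishes on every `C i`, and `⨆ C i = ⊤`. [cite: Liu2021, Prop. 4.13 (FJcycle.tex l. 2113–2119)] -/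
theorem eq_zero_of_exchange_of_multiplicityFree (C : ι → Submodule R H) (hint : DirectSum.IsInternal C)
    (hs : ∀ i, IsSimpleModule R (C i)) (hni : ∀ i j, Nonempty (C i ≃ₗ[R] C j) → i = j)
    {P Q : Submodule R H} (hPQ : IsCompl P Q) (E : H →ₗ[R] H) (hEP : P.map E ≤ Q) (hEQ : Q.map E ≤ P) : E = 0 := by
  classical
  letI : DirectSum.Decomposition C := hint.chooseDecomposition
  -- `E` vanishes on every simple component
  have hvan : ∀ (i : ι) (y : H), y ∈ C i → E y = 0 := by
    intro i y hy
    have hEy : E y ∈ C i := map_le_self_of_multiplicityFree C hint hs hni E i ⟨y, hy, rfl⟩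
    have hbot : P ⊓ Q = ⊥ := hPQ.inf_eq_bot
    rcases le_or_le_of_isCompl_of_multiplicityFree C hint hs hni hPQ i with hP | hQ
    · have h1 : E y ∈ Q := hEP ⟨y, hP hy, rfl⟩
      have h2 : E y ∈ P := hP hEy
      have : E y ∈ P ⊓ Q := ⟨h2, h1⟩
      rw [hbot] at this
      exact (Submodule.mem_bot R).1 this
    · have h1 : E y ∈ P := hEQ ⟨y, hQ hy, rfl⟩
      have h2 : E y ∈ Q := hQ hEy
      have : E y ∈ P ⊓ Q := ⟨h1, h2⟩
      rw [hbot] at this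
      exact (Submodule.mem_bot R).1 this
  ext x
  rw [← DirectSum.sum_support_decompose C x, map_sum]
  simp only [LinearMap.zero_apply]
  exact Finset.sum_eq_zero fun j _ => hvan j _ (DirectSum.decompose C x j).2

/-- **Bridge from the displayed shape of Prop 4.13** (`Nonempty (H ≃ₗ[R] ⨁ t, Ω t)`): the images of the summands form an internal direct sum
of `H` by submodules linearly equivalent to the `Ω t` (so `hs`∕`hni` transfer from the `Ω t`).
[cite: Liu2021, Prop. 4.13 (FJcycle.tex l. 2113–2119)] -/
theorem isInternal_map_of_equiv {T : Type*} [DecidableEq T] (Ω : T → Type*) [∀ t, AddCommGroup (Ω t)] [∀ t, Module R (Ω t)]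
    (e : H ≃ₗ[R] DirectSum T Ω) :
    DirectSum.IsInternal (fun t => (LinearMap.range (DirectSum.lof R T Ω t)).map (e.symm : DirectSum T Ω →ₗ[R] H)) := by
  classical
  -- the family of ranges of `lof` is internal in the direct sum itself
  have hD : DirectSum.IsInternal (fun t => LinearMap.range (DirectSum.lof R T Ω t)) := by
    rw [DirectSum.isInternal_submodule_iff_iSupIndep_and_iSup_eq_top]
    refine ⟨?_, ?_⟩
    · -- independence: the `t`-component kills `⨆ s ≠ t` and recovers the generator on `range (lof t)`
      intro t
      rw [disjoint_iff_inf_le]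
      rintro y ⟨⟨v, rfl⟩, hy⟩
      have hker : (⨆ s ≠ t, LinearMap.range (DirectSum.lof R T Ω s)) ≤
          LinearMap.ker (DirectSum.component R T Ω t) := by
        refine iSup₂_le fun s hs => ?_
        rintro _ ⟨w, rfl⟩
        rw [LinearMap.mem_ker, DirectSum.lof_eq_of, ← DirectSum.apply_eq_component, DirectSum.of_eq_of_ne _ _ _ hs.symm]
      have h1 : DirectSum.component R T Ω t (DirectSum.lof R T Ω t v) = 0 := hker hy
      rw [DirectSum.lof_eq_of, ← DirectSum.apply_eq_component, DirectSum.of_eq_same] at h1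
      rw [Submodule.mem_bot, h1, map_zero]
    · -- spanning: every element is the sum of its components
      rw [Submodule.eq_top_iff']
      intro v
      rw [← DirectSum.sum_support_of v]
      refine Submodule.sum_mem _ fun t _ => ?_
      exact Submodule.mem_iSup_of_mem t ⟨v t, DirectSum.lof_eq_of R T Ω t (v t)⟩
  -- transport along `e.symm`
  rw [DirectSum.isInternal_submodule_iff_iSupIndep_and_iSup_eq_top] at hD ⊢
  refine ⟨?_, ?_⟩
  · have : (fun t => (LinearMap.range (DirectSum.lof R T Ω t)).map (e.symm : DirectSum T Ω →ₗ[R] H)) =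
        Submodule.orderIsoMapComap e.symm ∘ (fun t => LinearMap.range (DirectSum.lof R T Ω t)) := rfl
    rw [this, iSupIndep_map_orderIso_iff]
    exact hD.1
  · rw [← Submodule.map_iSup, hD.2, Submodule.map_top, LinearMap.range_eq_top]
    exact e.symm.surjective

end Summit.HodgeConjecture.CorCM.D2Bridge.NotHJ
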